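import Literature.Geometry.Riemannian.RicciFlowScalarCurvatureLowerBound
import Literature.Geometry.Riemannian.RicciDeTurckChartFamily
import Literature.Geometry.Lorentzian.ChartMetricCoord
import Literature.Geometry.Lorentzian.DalembertianNaturality
import HarnessLib

/-!
# The evolution of the scalar curvature under the Ricci flow (Topping, Prop. 2.5.4) and Thm. 3.2.1
(topic `Geometry/Riemannian`; discharge of `ricciFlow_scalarCurvature_lowerBound`)

This file closes the proof of the named fact
`Literature.Geometry.Riemannian.ricciFlow_scalarCurvature_lowerBound` (**Topping 2006,
Thm. 3.2.1**: along a Ricci flow on a closed manifold, `R ≥ α` at `t = 0` gives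
`R ≥ α/(1 − (2α/n)t)`). By `RicciFlowScalarCurvatureLowerBound.lean` (weak minimum principle,
joint regularity of `R`, comparison ODE — all proved) the fact was reduced to the single input
**Topping 2006, Prop. 2.5.4** (p. 33; Hamilton 1982, Cor. 7.5): under the Ricci flow the scalar
curvature satisfies `∂R/∂t = ΔR + 2|Ric|²`. Here we PROVE Prop. 2.5.4 in the encoding of the layer
(`ricciFlow_hasDerivWithinAt_scalarCurvatureWith`) and conclude
(`ricciFlow_scalarCurvature_lowerBound_holds`).

## The proof of Prop. 2.5.4

The identity is local and tensorial, so it is proved in the chart of `M` at the point `x₀`: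

1. The inverse extended chart `Φ = chartInv I x₀ : chartTarget I x₀ → M` at `x₀` (an open subset
   of `E`, boundaryless model) is a smooth equidimensional immersion, so each `g t` pulls back
   to the metric `chartPullback I (g t) x₀` on the open set, with component map
   `chartRep I g x₀ t` (`G t y (v, w) = g_t(Φ y)(e.symmL v, e.symmL w)`, `e` the trivialization
   of `TM` at `x₀`) — the chart machinery of `RicciDeTurckNaturality.lean` /
   `RicciDeTurckChartFamily.lean`, reused.
2. `IsRicciFlow.isMetricFamilyOn_chartRep`, `IsRicciFlow.tDeriv_chartRep_eq` — along a Ricci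
   flow on `[0, T]`, `T > 0`, these components form a smooth one-parameter family on
   `target × [0, T]` (`MetricCoord.IsMetricFamilyOn`; joint smoothness `contDiffOn_chartRep`)
   satisfying the **Ricci flow in coordinates** `∂G/∂t = −2 Ric(G)` (the flow equation of
   `IsRicciFlow` on frame vectors, naturality of `Ric`, `ricci_comap_apply`, and
   `OpensChart.ricci_eq_ricAt`).
3. `MetricCoord.IsMetricFamilyOn.hasDerivWithinAt_scalAt_ricciFlow`
   (`CoordScalarCurvatureEvolution.lean`) — **Prop. 2.5.4 for the components**:
   `∂_t S(G) = Δ S(G) + 2|Ric(G)|²`, proved from the first variation of `Γ` and `Rm` (Topping,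
   Prop. 2.3.1, 2.3.4), the second and the contracted Bianchi identities
   (`CoordBianchi.lean`), all by Fréchet calculus on `E`.
4. Transport back: `S(G s)(φ x₀) = R(g s)(x₀)` (`scalarCurvature_comap`,
   `OpensChart.scalarCurvature_eq_scalAt`), `Δ_{G t} S(G t)(φ x₀) = Δ_{g t} R(·,t)(x₀)`
   (`dalembertian_comap`, `OpensChart.dalembertian_eq_lapAt`) and
   `|Ric(G t)|²(φ x₀) = |Ric(g t)|²(x₀)` (`normSq_chartPullback_eq` and
   `OpensChart.normSq_ricci_eq_normSqAt`); the Levi-Civita witnesses `cov t` of the flow enter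
   through `IsLeviCivita.ricci_eq_ricci`.

The degenerate time sets `T ≤ 0` are trivial (`[0, T]` has at most one point). No definition of
`Prop` type and no hypothesis is introduced; `ricciFlow_scalarCurvature_lowerBound_holds` is the
closed discharge.

## References

* P. Topping, *Lectures on the Ricci flow*, LMS Lecture Note Series 325, Cambridge Univ. Press
  2006: §2.3 (Prop. 2.3.1, 2.3.4, 2.3.9), §2.5, Prop. 2.5.4 (p. 33), §3.2, Thm. 3.2.1 (p. 36).
  [Topping2006]
* R. S. Hamilton, *Three-manifolds with positive Ricci curvature*, J. Differential Geom. 17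
  (1982), §7, Cor. 7.5. [Hamilton1982]
* B. O'Neill, *Semi-Riemannian geometry with applications to relativity*, 1983, Ch. 3,
  Prop. 3.59 (local isometries), Cor. 3.54. [ONeill1983]
-/

noncomputable section

-- nested operator spaces of metric components (`E →L E →L ℝ` and their derivatives)
set_option maxSynthPendingDepth 3

open Bundle Set Filter Module Function TopologicalSpace
open scoped Manifold ContDiff Topology

namespace Literature.Geometry.Riemannian

open Lorentzian Lorentzian.PseudoRiemannianMetric

universe u v w

/-! ### A Ricci flow read in a chart is a coordinate Ricci flow -/

section FlowInChart

variable {E : Type*} [NormedAddCommGroup E] [NormedSpace ℝ E] [FiniteDimensional ℝ E]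
  [CompleteSpace E] {H : Type*} [TopologicalSpace H] {I : ModelWithCorners ℝ E H} [I.Boundaryless]
  {M : Type*} [TopologicalSpace M] [ChartedSpace H M] [IsManifold I ∞ M]
  {g : ℝ → PseudoRiemannianMetric I ∞ E (TangentSpace I : M → Type _)}
  {cov : ℝ → CovariantDerivative I E (TangentSpace I : M → Type _)} {T : ℝ}

/-- **The chart components of a Ricci flow on `[0, T]`, `T > 0`, form a smooth one-parameter
family on `(chart target) × [0, T]`** (`MetricCoord.IsMetricFamilyOn`): each `G t` is smooth,
symmetric and nondegenerate (it represents the pullback metric), and `(y, t) ↦ G t y` is `C^∞`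
jointly (Topping 2006, §1.2.3: the family is smooth up to `t = 0` and `t = T`;
`IsContMDiffFamilyOn.contMDiffOn_gramOp` read in the chart). [cite: Topping2006, §1.2.3] -/
theorem IsRicciFlow.isMetricFamilyOn_chartRep (hflow : IsRicciFlow g cov (Icc 0 T)) (hT : 0 < T)
    (x₀ : M) :
    MetricCoord.IsMetricFamilyOn (chartRep I g x₀) (Icc 0 T) (extChartAt I x₀).target where
  isMetricOn t _ := Lorentzian.OpensChart.isMetricOn_repr (val_chartPullback_eq_chartRep g x₀ t)
  contDiffOn := contDiffOn_chartRep hflow.smooth x₀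
  uniqueDiffOn := uniqueDiffOn_Icc hT
  subset_closure_interior := by
    rw [interior_Icc, closure_Ioo hT.ne]

/-- **The Ricci flow equation in the chart**: the time derivative of the chart components is
`−2 Ric` of the components, `∂G/∂t = −2 Ric(G)` on `(chart target) × [0, T]` — the flow equation
`∂g/∂t = −2 Ric(g)` of `IsRicciFlow` on the frame vectors, naturality of the Ricci tensor under
`Φ` (`ricci_comap_apply`) and `OpensChart.ricci_eq_ricAt`. [cite: Topping2006, (1.1.1)] -/
theorem IsRicciFlow.tDeriv_chartRep_eq (hflow : IsRicciFlow g cov (Icc 0 T)) (hT : 0 < T) (x₀ : M)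
    {s : ℝ} (hs : s ∈ Icc 0 T) {y : E} (hy : y ∈ (extChartAt I x₀).target) :
    MetricCoord.tDeriv (chartRep I g x₀) (Icc 0 T) s y =
      (-2 : ℝ) • MetricCoord.ricAt (chartRep I g x₀ s) y := by
  have hfam := hflow.isMetricFamilyOn_chartRep hT x₀
  haveI := (g s).hasLeviCivita
  haveI := (chartPullback I (g s) x₀).hasLeviCivita
  have h2 : (2 : ℕ∞ω) ≤ ∞ := WithTop.coe_le_coe.mpr le_top
  set u : chartTarget I x₀ := ⟨y, hy⟩ with hu
  ext v w
  -- the component `s ↦ G s y v w` is `s ↦ g_s(Φ y)(X, Y)` with fixed frame vectors `X, Y`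
  have hd := (hfam.hasDerivWithinAt_apply₂ hy hs v w).derivWithin (uniqueDiffOn_Icc hT s hs)
  have hflowd := (hflow.hasDerivWithinAt s hs ((extChartAt I x₀).symm y)
    ((trivializationAt E (TangentSpace I : M → Type _) x₀).symmL ℝ ((extChartAt I x₀).symm y) v)
    ((trivializationAt E (TangentSpace I : M → Type _) x₀).symmL ℝ ((extChartAt I x₀).symm y) w)).derivWithin
    (uniqueDiffOn_Icc hT s hs)
  change derivWithin (fun s' ↦ (g s').val ((extChartAt I x₀).symm y)
      ((trivializationAt E (TangentSpace I : M → Type _) x₀).symmL ℝ ((extChartAt I x₀).symm y) v)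
      ((trivializationAt E (TangentSpace I : M → Type _) x₀).symmL ℝ ((extChartAt I x₀).symm y) w))
    (Icc 0 T) s = _ at hd
  rw [hflowd] at hd
  rw [← hd, _root_.smul_apply, _root_.smul_apply, smul_eq_mul,
    (hflow.isLeviCivita s hs).ricci_eq_ricci h2,
    ← Lorentzian.OpensChart.ricci_eq_ricAt (val_chartPullback_eq_chartRep g x₀ s) u v w,
    (g s).ricci_comap_apply contMDiff_pullbackBilin_holds (contMDiff_chartInv x₀)
      (injective_mfderiv_chartInv x₀) rfl u v w,
    mfderiv_chartInv_eq_symmL x₀ u v, mfderiv_chartInv_eq_symmL x₀ u w]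
  rfl

/-- **The scalar curvature of the flow read in the chart**: `S(G s)(u) = R(g s)(Φ u)` for the
Levi-Civita witness `cov s` (`scalarCurvature_comap`, `OpensChart.scalarCurvature_eq_scalAt`,
`IsLeviCivita.ricci_eq_ricci`). [cite: ONeill1983, Ch. 3, Prop. 3.59] -/
theorem IsRicciFlow.scalAt_chartRep_eq (hflow : IsRicciFlow g cov (Icc 0 T)) (x₀ : M) {s : ℝ}
    (hs : s ∈ Icc 0 T) (u : chartTarget I x₀) :
    MetricCoord.scalAt (chartRep I g x₀ s) u = (g s).scalarCurvatureWith (cov s) (chartInv I x₀ u) := by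
  haveI := (g s).hasLeviCivita
  haveI := (chartPullback I (g s) x₀).hasLeviCivita
  have h2 : (2 : ℕ∞ω) ≤ ∞ := WithTop.coe_le_coe.mpr le_top
  rw [← Lorentzian.OpensChart.scalarCurvature_eq_scalAt (val_chartPullback_eq_chartRep g x₀ s) u,
    (g s).scalarCurvature_comap contMDiff_pullbackBilin_holds (contMDiff_chartInv x₀)
      (injective_mfderiv_chartInv x₀) rfl u,
    scalarCurvatureWith, (hflow.isLeviCivita s hs).ricci_eq_ricci h2]
  rfl

/-- **Topping 2006, Prop. 2.5.4 for a Ricci flow on `[0, T]`, `T > 0`** (any manifold with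
boundaryless finite-dimensional model; no compactness or signature is needed): at every
`t ∈ [0, T]` and `x₀ : M` the scalar curvature `s ↦ R(x₀, s)` has derivative
`Δ_{g(t)} R(·, t)(x₀) + 2|Ric(g(t))|²(x₀)` within `[0, T]`. [cite: Topping2006, Prop. 2.5.4] -/
theorem IsRicciFlow.hasDerivWithinAt_scalarCurvatureWith (hflow : IsRicciFlow g cov (Icc 0 T))
    (hT : 0 < T) {t : ℝ} (ht : t ∈ Icc 0 T) (x₀ : M) :
    HasDerivWithinAt (fun s ↦ (g s).scalarCurvatureWith (cov s) x₀)
      ((g t).laplaceBeltrami (fun y ↦ (g t).scalarCurvatureWith (cov t) y) x₀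
        + 2 * (g t).normSq x₀ ((cov t).ricci x₀)) (Icc 0 T) t := by
  have hfam := hflow.isMetricFamilyOn_chartRep hT x₀
  have hfl : ∀ s ∈ Icc 0 T, ∀ y ∈ (extChartAt I x₀).target,
      MetricCoord.tDeriv (chartRep I g x₀) (Icc 0 T) s y =
        (-2 : ℝ) • MetricCoord.ricAt (chartRep I g x₀ s) y := fun s hs y hy ↦
    hflow.tDeriv_chartRep_eq hT x₀ hs hy
  have hu₀ : extChartAt I x₀ x₀ ∈ (extChartAt I x₀).target := mem_extChartAt_target x₀
  set u₀ : chartTarget I x₀ := ⟨extChartAt I x₀ x₀, hu₀⟩ with hu₀def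
  have hΦu₀ : chartInv I x₀ u₀ = x₀ := extChartAt_to_inv x₀
  -- Prop. 2.5.4 for the components
  have key := hfam.hasDerivWithinAt_scalAt_ricciFlow hfl hu₀ ht
  -- transport of the function
  have hfun : ∀ s ∈ Icc 0 T, (g s).scalarCurvatureWith (cov s) x₀ =
      MetricCoord.scalAt (chartRep I g x₀ s) (extChartAt I x₀ x₀) := fun s hs ↦ by
    rw [show extChartAt I x₀ x₀ = (u₀ : E) from rfl, hflow.scalAt_chartRep_eq x₀ hs u₀, hΦu₀]
  refine (key.congr_of_mem hfun ht).congr_deriv ?_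
  -- transport of the Laplacian and of `|Ric|²`
  haveI := (g t).hasLeviCivita
  haveI := (chartPullback I (g t) x₀).hasLeviCivita
  have h2 : (2 : ℕ∞ω) ≤ ∞ := WithTop.coe_le_coe.mpr le_top
  have hG := val_chartPullback_eq_chartRep g x₀ t
  -- (a) `|Ric|²`
  have hnorm : MetricCoord.normSqAt (chartRep I g x₀ t) (extChartAt I x₀ x₀)
      (MetricCoord.ricAt (chartRep I g x₀ t) (extChartAt I x₀ x₀)) =
      (g t).normSq x₀ ((cov t).ricci x₀) := by
    rw [show extChartAt I x₀ x₀ = (u₀ : E) from rfl,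
      ← Lorentzian.OpensChart.normSq_ricci_eq_normSqAt hG u₀,
      normSq_chartPullback_eq (g t) x₀ u₀ _ ((g t).ricci (chartInv I x₀ u₀))
        (fun v w ↦ (g t).ricci_comap_apply contMDiff_pullbackBilin_holds (contMDiff_chartInv x₀)
          (injective_mfderiv_chartInv x₀) rfl u₀ v w),
      hΦu₀, (hflow.isLeviCivita t ht).ricci_eq_ricci h2]
  -- (b) the Laplacian: the scalar curvature function on `M` and its pullback
  set Rf : M → ℝ := fun y ↦ (g t).scalarCurvatureWith (cov t) y with hRf
  have hRsmooth : CMDiffAt 2 Rf (chartInv I x₀ u₀) :=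
    ((hflow.isLeviCivita t ht).contMDiff_trace_ricci (chartInv I x₀ u₀)).of_le h2
  have hrep : ∀ u : chartTarget I x₀, (Rf ∘ chartInv I x₀) u = MetricCoord.scalAt (chartRep I g x₀ t) u :=
    fun u ↦ (hflow.scalAt_chartRep_eq x₀ ht u).symm
  have hscal : ContDiffAt ℝ 2 (MetricCoord.scalAt (chartRep I g x₀ t)) (u₀ : E) :=
    ((hfam.isMetricOn t ht).contDiffAt_scalAt hu₀).of_le h2
  have hlap : MetricCoord.lapAt (chartRep I g x₀ t) (MetricCoord.scalAt (chartRep I g x₀ t))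
      (extChartAt I x₀ x₀) = (g t).laplaceBeltrami Rf x₀ := by
    rw [show extChartAt I x₀ x₀ = (u₀ : E) from rfl,
      ← Lorentzian.OpensChart.dalembertian_eq_lapAt hG u₀ hrep hscal,
      (g t).dalembertian_comap contMDiff_pullbackBilin_holds (contMDiff_chartInv x₀)
        (injective_mfderiv_chartInv x₀) rfl hRsmooth,
      hΦu₀, laplaceBeltrami_eq_dalembertian]
  rw [hlap, hnorm]

end FlowInChart

/-! ### Prop. 2.5.4 in the encoding of the layer, and the discharge of Thm. 3.2.1 -/

/-- **Topping 2006, Prop. 2.5.4 (evolution of the scalar curvature under the Ricci flow), in the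
encoding of `ricciFlow_scalarCurvature_lowerBound_of_evolution`**: for every Ricci flow of
Riemannian metrics on `[0, T]` on a closed `C^∞` manifold, at every `t ∈ [0, T]` and `x : M` the
function `s ↦ R(x, s)` has derivative `Δ_{g(t)} R(·, t)(x) + 2|Ric(g(t))|²(x)` within `[0, T]`,
"`∂R/∂t = ΔR + 2|Ric|²`" (Topping 2006, (2.5.5), p. 33; Hamilton 1982, Cor. 7.5). (Signature,
compactness and separation are not used; `[0, T]` with `T ≤ 0` has at most one point and the
statement is then trivial.) [cite: Topping2006, Prop. 2.5.4] -/
theorem ricciFlow_hasDerivWithinAt_scalarCurvatureWith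
    {E : Type u} [NormedAddCommGroup E] [NormedSpace ℝ E] [FiniteDimensional ℝ E]
    [CompleteSpace E] {H : Type v} [TopologicalSpace H] (I : ModelWithCorners ℝ E H)
    [I.Boundaryless] (M : Type w) [TopologicalSpace M] [T2Space M] [SecondCountableTopology M]
    [CompactSpace M] [ChartedSpace H M] [IsManifold I ∞ M] (T : ℝ)
    (g : ℝ → PseudoRiemannianMetric I ∞ E (TangentSpace I : M → Type _))
    (cov : ℝ → CovariantDerivative I E (TangentSpace I : M → Type _))
    (hflow : IsRicciFlow g cov (Icc 0 T)) (_hR : ∀ t ∈ Icc 0 T, (g t).IsRiemannian) :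
    ∀ t ∈ Icc 0 T, ∀ x : M,
      HasDerivWithinAt (fun s ↦ (g s).scalarCurvatureWith (cov s) x)
        ((g t).laplaceBeltrami (fun y ↦ (g t).scalarCurvatureWith (cov t) y) x
          + 2 * (g t).normSq x ((cov t).ricci x)) (Icc 0 T) t := by
  intro t ht x
  rcases lt_or_ge 0 T with hT | hT
  · exact hflow.hasDerivWithinAt_scalarCurvatureWith hT ht x
  · -- `[0, T]` has at most one point
    exact HasFDerivWithinAt.of_subsingleton (Set.subsingleton_Icc_of_ge hT)

/-- **Topping 2006, Thm. 3.2.1 — the named fact `ricciFlow_scalarCurvature_lowerBound` holds.**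
Along a Ricci flow of Riemannian metrics on `[0, T]` on a closed manifold, `R ≥ α` at `t = 0`
gives `R(·, t) ≥ α / (1 − (2α/n) t)` as long as `1 − (2α/n) t > 0`: the weak minimum principle
(Topping, Cor. 3.1.2) applied to the evolution inequality `∂R/∂t ≥ ΔR + (2/n)R²` (Cor. 2.5.5 of
Prop. 2.5.4, `ricciFlow_hasDerivWithinAt_scalarCurvatureWith`) with the comparison ODE
`φ' = (2/n)φ²` — assembled in `ricciFlow_scalarCurvature_lowerBound_of_evolution`.
[cite: Topping2006, Thm. 3.2.1 (p. 36)] -/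
theorem ricciFlow_scalarCurvature_lowerBound_holds : ricciFlow_scalarCurvature_lowerBound.{u, v, w} := by
  refine ricciFlow_scalarCurvature_lowerBound_of_evolution ?_
  intro E _ _ _ _ H _ I _ M _ _ _ _ _ _ T g cov hflow hR
  exact ricciFlow_hasDerivWithinAt_scalarCurvatureWith I M T g cov hflow hR

end Literature.Geometry.Riemannian

end
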